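import Literature.AlgebraicGeometry.ShimuraVarieties.UnitaryBallFormPullback
import Literature.AlgebraicGeometry.ShimuraVarieties.UnitaryBallDiscontinuity
import Literature.Analysis.Complex.InjectiveHolomorphic

/-!
# The ball uniformization is a local biholomorphism

Let `D : UnitaryBallUniformisationDatum 2 X₂` be a ball uniformization `Γ\𝔹² ≅ X₂(ℂ)` of a smooth
projective surface, `A : HodgeModel 2 X₂` a Hodge model (the complex manifold `X^an`, charted on
the `2`-dimensional complex normed space `A.model`) and `𝔣` a Sylvester frame, so that
`ψ = D.modelUnif A 𝔣 : ℂ² → X^an` is the uniformization read on the standard ball: holomorphic on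
the ball (`unifHolomorphic`), with fibres the `Γ`-orbits (`modelUnif_eq_iff`). Since `Γ` acts
freely and properly discontinuously (`UnitaryBallDiscontinuity`), `ψ` is injective near every
ball point (`exists_isOpen_injOn_modelUnif`). An injective holomorphic map between complex
manifolds of the same dimension is a local biholomorphism (Clements–Osgood,
`Literature.Analysis.Complex.SCV.bijective_fderiv_of_injOn` / `isOpen_image_of_injOn` /
`differentiableOn_symm_of_differentiableOn`, PROVED in the tree after Fritzsche–Grauert, Ch. I §8).
We record this as:

* `ChartInverse D A 𝔣 z` / `nonempty_chartInverse` — a **holomorphic local inverse of `ψ` read in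
  the preferred chart `c` of `X^an` at `ψ z`**: an open `W ∋ c(ψ z)` in `A.model` and a holomorphic
  `g : W → 𝔹²` with `g (c (ψ z)) = z` and `c⁻¹ = ψ ∘ g` on `W`; the chain rule
  `d(c⁻¹)_y = dψ_{g y} ∘ dg_y` (`ChartInverse.mfderivWithin_symm_eq`);
* `bijective_unifDeriv` — the real differential `dψ_z : ℂ² → T_{ψ z} X^an = A.model` is bijective
  at every ball point, packaged as the continuous linear equivalence `unifDerivEquiv` (whose
  inverse is `ℂ`-linear, `unifDerivEquiv_symm_smul`, and `Γ`-equivariant,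
  `unifDerivEquiv_symm_smul_point`: `(dψ_{γ z})⁻¹ = J(γ, z) ∘ (dψ_z)⁻¹`).

These are the tools for descending holomorphic automorphic forms on `𝔹²` to holomorphic forms on
`X^an` (`UnitaryBallHolomorphicDescent`). All statements are theorems; the one `structure` is a
package of data produced by `nonempty_chartInverse`.

References: K. Fritzsche, H. Grauert, *From Holomorphic Functions to Complex Manifolds* (2002),
Ch. I §8 Thm. 8.5, Cor. 8.6, Ch. IV §1 (complex manifolds, local biholomorphisms);
N. Bergeron, J. Millson, C. Moeglin, Acta Math. 216 (2016), Introduction §1.1 (`S(Γ) = Γ\X` is a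
complex manifold for torsion-free `Γ`).

## Provenance

Written under the LEAN-IN-TREE rule for the pub-hodgecm formalisation cell (model-construction
sub-cell, seat mc-autform-1 gen 2, MODEL-DAG node D1-G-iii-c, step K2 of the descent chain).
Nothing in this file is a claim of the manuscripts adjudicated by that cell.
-/

noncomputable section

open Matrix MulAction Function Set Filter Complex
open scoped Manifold Topology
open Literature.Geometry.ComplexHyperbolic
open Literature.Geometry.ComplexHyperbolic.BallModel (U21 Ball Jac nsq)
open Literature.NumberTheory.Transcendental
open Literature.AlgebraicGeometry.HodgeTheory (HodgeModel)
open Literature.Analysis.Complex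

namespace Literature.AlgebraicGeometry.ShimuraVarieties

namespace UnitaryBallUniformisationDatum

variable {X₂ : Motives.SchemeOver ℂ} (D : UnitaryBallUniformisationDatum 2 X₂) (A : HodgeModel 2 X₂)
  (𝔣 : D.SylvesterFrame)

/-! ### Local injectivity of `ψ` on `ℂ²` -/

/-- **Local injectivity of the uniformization**: every ball point has an open neighbourhood in
`ℂ²`, inside the ball, on which `ψ = modelUnif` is injective (the fibres of `ψ` are the
`Γ`-orbits and `Γ` acts freely and properly discontinuously).
[cite: BergeronMillsonMoeglin2016Balls, Introduction §1.1] -/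
theorem exists_isOpen_injOn_modelUnif (z : Ball) :
    ∃ U : Set (Fin 2 → ℂ), IsOpen U ∧ z.1 ∈ U ∧ U ⊆ BallForms.ballSet ∧
      InjOn (D.modelUnif A 𝔣) U := by
  obtain ⟨U₀, hU₀, hz, hinj⟩ := D.exists_isOpen_injOn_ballUnifMap 𝔣 z
  have hval : IsOpenMap (Subtype.val : Ball → Fin 2 → ℂ) := by
    have h : IsOpen {w : Fin 2 → ℂ | nsq w < 1} := BallForms.isOpen_ballSet
    exact h.isOpenMap_subtype_val
  refine ⟨Subtype.val '' U₀, hval _ hU₀, ⟨z, hz, rfl⟩, ?_, ?_⟩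
  · rintro _ ⟨w, -, rfl⟩
    exact BallForms.coe_mem_ballSet w
  · rintro _ ⟨w, hw, rfl⟩ _ ⟨w', hw', rfl⟩ h
    have h' : D.ballUnifMap 𝔣 w = D.ballUnifMap 𝔣 w' := by
      rw [modelUnif_coe, modelUnif_coe] at h
      exact A.isAnalytification.homeomorph.symm.injective h
    rw [hinj hw hw' h']

/-- `dim_ℂ ℂ² = dim_ℂ A.model` (`X^an` is a surface). [folklore] -/
theorem finrank_fin_two_eq_finrank_model :
    Module.finrank ℂ (Fin 2 → ℂ) = Module.finrank ℂ A.model := by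
  rw [Module.finrank_fin_fun, A.isAnalytification.finrank_eq]

/-! ### A holomorphic local inverse of `ψ` in a chart -/

/-- **A holomorphic local inverse of the uniformization read in the preferred chart `c` of `X^an`
at `ψ z`**: an open set `W ∋ c (ψ z)` of the model space and a map `g : A.model → ℂ²`,
complex-differentiable on `W`, with `g (c (ψ z)) = z`, `g(W) ⊆ 𝔹²`, `W ⊆ c.target` and
`c⁻¹ = ψ ∘ g` on `W`. [cite: FritzscheGrauert2002, Ch. I §8 Cor. 8.6] -/
structure ChartInverse (z : Ball) where
  /-- the open set of the chart target on which the inverse is defined -/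
  W : Set A.model
  /-- the local inverse `g : W → 𝔹² ⊆ ℂ²` (total function, meaningful on `W`) -/
  g : A.model → (Fin 2 → ℂ)
  isOpen : IsOpen W
  center_mem : extChartAt 𝓘(ℝ, A.model) (D.modelUnif A 𝔣 z.1) (D.modelUnif A 𝔣 z.1) ∈ W
  g_center : g (extChartAt 𝓘(ℝ, A.model) (D.modelUnif A 𝔣 z.1) (D.modelUnif A 𝔣 z.1)) = z.1
  differentiableOn : DifferentiableOn ℂ g W
  mapsTo : MapsTo g W BallForms.ballSet
  subset_target : W ⊆ (extChartAt 𝓘(ℝ, A.model) (D.modelUnif A 𝔣 z.1)).target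
  symm_eq : ∀ y ∈ W,
    (extChartAt 𝓘(ℝ, A.model) (D.modelUnif A 𝔣 z.1)).symm y = D.modelUnif A 𝔣 (g y)

/-- **The uniformization is a local biholomorphism** (Clements–Osgood applied to `c ∘ ψ`, which
is injective and holomorphic near `z`): a holomorphic local inverse of `ψ` in the chart at `ψ z`
exists. [cite: FritzscheGrauert2002, Ch. I §8 Cor. 8.6] -/
theorem nonempty_chartInverse (z : Ball) : Nonempty (D.ChartInverse A 𝔣 z) := by
  set ψ := D.modelUnif A 𝔣 with hψ
  set x : A.carrier := ψ z.1 with hx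
  set φ := extChartAt 𝓘(ℝ, A.model) x with hφ
  obtain ⟨U, hUo, hzU, hUB, hinjU⟩ := D.exists_isOpen_injOn_modelUnif A 𝔣 z
  -- the open set `O ∋ z` on which `Y = φ ∘ ψ` is an injective holomorphic map
  set O : Set (Fin 2 → ℂ) := U ∩ ψ ⁻¹' (chartAt A.model x).source with hO
  have hOo : IsOpen O :=
    ((D.continuousOn_modelUnif A 𝔣).mono hUB).isOpen_inter_preimage hUo
      (chartAt A.model x).open_source
  have hzO : z.1 ∈ O := ⟨hzU, mem_chart_source _ x⟩
  have hOB : O ⊆ BallForms.ballSet := fun w hw ↦ hUB hw.1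
  have hsrc : ∀ w ∈ O, ψ w ∈ φ.source := fun w hw ↦ by
    rw [hφ, extChartAt_source]; exact hw.2
  set Y : (Fin 2 → ℂ) → A.model := fun w ↦ φ (ψ w) with hY
  have hYd : DifferentiableOn ℂ Y O := fun w hw ↦ by
    have h1 : MDifferentiableAt 𝓘(ℂ, Fin 2 → ℂ) 𝓘(ℂ, A.model) ψ w :=
      (D.unifHolomorphic A 𝔣).mdifferentiableAt (BallForms.isOpen_ballSet.mem_nhds (hOB hw))
    have h2 : MDifferentiableAt 𝓘(ℂ, A.model) 𝓘(ℂ, A.model)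
        (extChartAt 𝓘(ℂ, A.model) x) (ψ w) :=
      mdifferentiableAt_extChartAt hw.2
    exact (mdifferentiableAt_iff_differentiableAt.1 (h2.comp w h1)).differentiableWithinAt
  have hYinj : InjOn Y O := by
    intro w hw w' hw' h
    exact hinjU hw.1 hw'.1 (φ.injOn (hsrc w hw) (hsrc w' hw') h)
  have hdim := finrank_fin_two_eq_finrank_model A
  -- `Y : O → Y(O)` is an open partial homeomorphism
  haveI : Nonempty (Fin 2 → ℂ) := ⟨0⟩
  set e : PartialEquiv (Fin 2 → ℂ) A.model := hYinj.toPartialEquiv Y O with he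
  have hopen : IsOpenMap (O.restrict Y) := by
    intro s hs
    obtain ⟨V, hV, rfl⟩ := isOpen_induced_iff.1 hs
    have himg : O.restrict Y '' (Subtype.val ⁻¹' V) = Y '' (O ∩ V) := by
      ext y
      constructor
      · rintro ⟨⟨w, hwO⟩, hwV, rfl⟩
        exact ⟨w, ⟨hwO, hwV⟩, rfl⟩
      · rintro ⟨w, ⟨hwO, hwV⟩, rfl⟩
        exact ⟨⟨w, hwO⟩, hwV, rfl⟩
    rw [himg]
    exact SCV.isOpen_image_of_injOn hdim (hYd.mono inter_subset_left) (hOo.inter hV)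
      (hYinj.mono inter_subset_left)
  set T : OpenPartialHomeomorph (Fin 2 → ℂ) A.model :=
    OpenPartialHomeomorph.ofContinuousOpenRestrict e hYd.continuousOn hopen hOo with hT
  have hTd : DifferentiableOn ℂ T T.source := hYd
  have hgd : DifferentiableOn ℂ T.symm (Y '' O) :=
    SCV.differentiableOn_symm_of_differentiableOn hdim T hTd
  refine ⟨{ W := Y '' O
            g := T.symm
            isOpen := SCV.isOpen_image_of_injOn hdim hYd hOo hYinj
            center_mem := ⟨z.1, hzO, rfl⟩
            g_center := T.left_inv hzO
            differentiableOn := hgd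
            mapsTo := fun y hy ↦ hOB (T.map_target hy)
            subset_target := ?_
            symm_eq := ?_ }⟩
  · rintro _ ⟨w, hw, rfl⟩
    exact φ.map_source (hsrc w hw)
  · intro y hy
    have hgy : T.symm y ∈ O := T.map_target hy
    have hright : Y (T.symm y) = y := T.right_inv hy
    calc φ.symm y = φ.symm (Y (T.symm y)) := by rw [hright]
      _ = ψ (T.symm y) := φ.left_inv (hsrc _ hgy)

namespace ChartInverse

variable {D A 𝔣} {z : Ball} (c : D.ChartInverse A 𝔣 z)

/-- Points of `W` lie in the chart target. [folklore] -/
theorem mem_target {y : A.model} (hy : y ∈ c.W) :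
    y ∈ (extChartAt 𝓘(ℝ, A.model) (D.modelUnif A 𝔣 z.1)).target :=
  c.subset_target hy

/-- `g` maps `W` into the ball. [folklore] -/
theorem g_mem {y : A.model} (hy : y ∈ c.W) : c.g y ∈ BallForms.ballSet :=
  c.mapsTo hy

/-- The ball point `g y`. [folklore] -/
def gBall {y : A.model} (hy : y ∈ c.W) : Ball :=
  ⟨c.g y, c.g_mem hy⟩

/-- The underlying point of `gBall` is `g y`. [folklore] -/
@[simp] theorem coe_gBall {y : A.model} (hy : y ∈ c.W) : (c.gBall hy).1 = c.g y := rfl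

/-- `g` is complex-differentiable at the points of `W`. [folklore] -/
theorem differentiableAt {y : A.model} (hy : y ∈ c.W) : DifferentiableAt ℂ c.g y :=
  c.differentiableOn.differentiableAt (c.isOpen.mem_nhds hy)

/-- **Chain rule for `c⁻¹ = ψ ∘ g`**: `d(c⁻¹)_y = dψ_{g y} ∘ dg_y` on `W` (real differentials).
[cite: VoisinHodgeI2002, §2.2.1] -/
theorem mfderivWithin_symm_eq {y : A.model} (hy : y ∈ c.W) :
    mfderivWithin 𝓘(ℝ, A.model) 𝓘(ℝ, A.model)
        (extChartAt 𝓘(ℝ, A.model) (D.modelUnif A 𝔣 z.1)).symm (range 𝓘(ℝ, A.model)) y =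
      (D.unifDeriv A 𝔣 (c.g y)).comp (fderiv ℝ c.g y) := by
  set ψ := D.modelUnif A 𝔣 with hψ
  set φ := extChartAt 𝓘(ℝ, A.model) (ψ z.1) with hφ
  have h1 : HasMFDerivAt 𝓘(ℝ, A.model) 𝓘(ℝ, Fin 2 → ℂ) c.g y (fderiv ℝ c.g y) :=
    hasMFDerivAt_iff_hasFDerivAt.2 ((c.differentiableAt hy).restrictScalars ℝ).hasFDerivAt
  have h2 : HasMFDerivAt 𝓘(ℝ, Fin 2 → ℂ) 𝓘(ℝ, A.model) ψ (c.g y)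
      (D.unifDeriv A 𝔣 (c.g y)) :=
    (D.mdifferentiableAt_modelUnif A 𝔣 (c.gBall hy)).real_of_complex.hasMFDerivAt
  have h3 : HasMFDerivAt 𝓘(ℝ, A.model) 𝓘(ℝ, A.model) φ.symm y
      (mfderivWithin 𝓘(ℝ, A.model) 𝓘(ℝ, A.model) φ.symm (range 𝓘(ℝ, A.model)) y) :=
    (mdifferentiableWithinAt_extChartAt_symm (c.mem_target hy)).hasMFDerivWithinAt.hasMFDerivAt
      (by rw [ModelWithCorners.Boundaryless.range_eq_univ]; exact univ_mem)
  have hev : φ.symm =ᶠ[𝓝 y] ψ ∘ c.g := by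
    filter_upwards [c.isOpen.mem_nhds hy] with y' hy'
    exact c.symm_eq y' hy'
  rw [← h3.mfderiv]
  exact ((h2.comp y h1).congr_of_eventuallyEq hev).mfderiv

end ChartInverse

/-! ### The differential of `ψ` is invertible -/

/-- **`dψ_z` is bijective at every ball point** (`ψ` is a local biholomorphism).
[cite: FritzscheGrauert2002, Ch. I §8 Thm. 8.5] -/
theorem bijective_unifDeriv (z : Ball) : Function.Bijective (D.unifDeriv A 𝔣 z.1) := by
  obtain ⟨c⟩ := D.nonempty_chartInverse A 𝔣 z
  have hid := c.mfderivWithin_symm_eq c.center_mem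
  rw [c.g_center] at hid
  have hinv := isInvertible_mfderivWithin_extChartAt_symm (I := 𝓘(ℝ, A.model))
    (c.mem_target c.center_mem)
  rw [hid] at hinv
  have hsurj : Function.Surjective (D.unifDeriv A 𝔣 z.1) := by
    obtain ⟨M, hM⟩ := hinv
    intro v
    refine ⟨fderiv ℝ c.g
      (extChartAt 𝓘(ℝ, A.model) (D.modelUnif A 𝔣 z.1) (D.modelUnif A 𝔣 z.1)) (M.symm v), ?_⟩
    have h := congrArg (fun f : A.model →L[ℝ] A.model ↦ f (M.symm v)) hM
    simp only [ContinuousLinearMap.comp_apply] at h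
    rw [← h]
    exact M.apply_symm_apply v
  refine ⟨?_, hsurj⟩
  have hdim : Module.finrank ℝ (Fin 2 → ℂ) = Module.finrank ℝ A.model := by
    rw [finrank_real_of_complex, finrank_real_of_complex, finrank_fin_two_eq_finrank_model A]
  exact (LinearMap.injective_iff_surjective_of_finrank_eq_finrank hdim
    (f := (D.unifDeriv A 𝔣 z.1 : (Fin 2 → ℂ) →ₗ[ℝ] A.model))).2 hsurj

/-- **The differential of the uniformization as a continuous linear equivalence**
`dψ_z : ℂ² ≃ T_{ψ z} X^an = A.model` (real scalars). [cite: FritzscheGrauert2002, Ch. I §8 Thm. 8.5] -/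
def unifDerivEquiv (z : Ball) : (Fin 2 → ℂ) ≃L[ℝ] A.model :=
  (LinearEquiv.ofBijective (D.unifDeriv A 𝔣 z.1 : (Fin 2 → ℂ) →ₗ[ℝ] A.model)
    (D.bijective_unifDeriv A 𝔣 z)).toContinuousLinearEquiv

/-- `unifDerivEquiv z v = dψ_z v`. [folklore] -/
@[simp] theorem unifDerivEquiv_apply (z : Ball) (v : Fin 2 → ℂ) :
    D.unifDerivEquiv A 𝔣 z v = D.unifDeriv A 𝔣 z.1 v :=
  rfl

/-- `dψ_z ((dψ_z)⁻¹ v) = v`. [folklore] -/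
@[simp] theorem unifDeriv_symm_apply (z : Ball) (v : A.model) :
    D.unifDeriv A 𝔣 z.1 ((D.unifDerivEquiv A 𝔣 z).symm v) = v :=
  (D.unifDerivEquiv A 𝔣 z).apply_symm_apply v

/-- `(dψ_z)⁻¹ (dψ_z u) = u`. [folklore] -/
@[simp] theorem symm_unifDeriv_apply (z : Ball) (u : Fin 2 → ℂ) :
    (D.unifDerivEquiv A 𝔣 z).symm (D.unifDeriv A 𝔣 z.1 u) = u :=
  (D.unifDerivEquiv A 𝔣 z).symm_apply_apply u

/-- The inverse differential `(dψ_z)⁻¹` is `ℂ`-linear. [cite: VoisinHodgeI2002, §2.2.1] -/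
theorem unifDerivEquiv_symm_smul (z : Ball) (a : ℂ) (v : A.model) :
    (D.unifDerivEquiv A 𝔣 z).symm (a • v) = a • (D.unifDerivEquiv A 𝔣 z).symm v := by
  apply (D.unifDerivEquiv A 𝔣 z).injective
  rw [ContinuousLinearEquiv.apply_symm_apply, unifDerivEquiv_apply, unifDeriv_smul,
    unifDeriv_symm_apply]

/-- **Equivariance of the inverse differential**: `(dψ_{γ z})⁻¹ = J(γ, z) ∘ (dψ_z)⁻¹`
(from the chain rule `dψ_z = dψ_{γ z} ∘ J(γ, z)`). [cite: VoisinHodgeI2002, §2.2.1] -/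
theorem unifDerivEquiv_symm_smul_point (γ : D.Γ) (z : Ball) (v : A.model) :
    (D.unifDerivEquiv A 𝔣 (D.ballRep 𝔣 γ • z)).symm v =
      Jac (D.ballRep 𝔣 γ) z *ᵥ (D.unifDerivEquiv A 𝔣 z).symm v := by
  apply (D.unifDerivEquiv A 𝔣 (D.ballRep 𝔣 γ • z)).injective
  rw [ContinuousLinearEquiv.apply_symm_apply, unifDerivEquiv_apply, ← jacCLM_apply,
    ← ContinuousLinearMap.comp_apply, ← unifDeriv_eq_comp, unifDeriv_symm_apply]

namespace ChartInverse

variable {D A 𝔣} {z : Ball} (c : D.ChartInverse A 𝔣 z)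

/-- In the chart: `(dψ_{g y})⁻¹ ∘ d(c⁻¹)_y = dg_y` on `W`. [cite: VoisinHodgeI2002, §2.2.1] -/
theorem symm_mfderivWithin_symm_apply {y : A.model} (hy : y ∈ c.W) (v : A.model) :
    (D.unifDerivEquiv A 𝔣 (c.gBall hy)).symm
        (mfderivWithin 𝓘(ℝ, A.model) 𝓘(ℝ, A.model)
          (extChartAt 𝓘(ℝ, A.model) (D.modelUnif A 𝔣 z.1)).symm (range 𝓘(ℝ, A.model)) y v) =
      fderiv ℝ c.g y v := by
  rw [ContinuousLinearEquiv.symm_apply_eq, c.mfderivWithin_symm_eq hy]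
  rfl

/-- The complex derivative of `g` restricts to the real one. [folklore] -/
theorem fderiv_restrictScalars {y : A.model} (hy : y ∈ c.W) :
    (fderiv ℂ c.g y).restrictScalars ℝ = fderiv ℝ c.g y :=
  ((c.differentiableAt hy).fderiv_restrictScalars ℝ).symm

end ChartInverse

end UnitaryBallUniformisationDatum

end Literature.AlgebraicGeometry.ShimuraVarieties

end
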